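import Literature.AlgebraicGeometry.Resolution.BlowupAxialDivisor
import Literature.AlgebraicGeometry.Resolution.BlowupsIntegral
import Literature.AlgebraicGeometry.Resolution.BlowupsProperProofs
import Literature.AlgebraicGeometry.Resolution.BlowupSequences
import Mathlib.RingTheory.Ideal.KrullsHeightTheorem
import HarnessLib

/-!
# The axial tower of blowing ups: iterating the axial point, and its divisorial restart

Topic: `Literature/AlgebraicGeometry/Resolution`. Bookkeeping for Hironaka's TEST sequences of
blowing ups (the type-(I)/(II) towers of the numerical character of `𝔖(E)`; Cossart–Piltant's
sequences of point blow-ups read along an axis; Lipman's quadratic sequences): a STAGE is an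
integral locally Noetherian scheme `X` with a point `P` whose local ring is regular and a regular
system of parameters `c = (t, y₁, …, y_n)` generating `𝔪_P` (`AxStage n`). Its successor
(`AxStage.next`) is the tree's chosen blowing up `Bl_{cl{P}} X` along the reduced closed subscheme
`cl{P}`, pointed at the AXIAL POINT over `P` (`exists_axialPoint`, `BlowupAxialPoint.lean`: the point
`(t, y/t)` of the chart of `t`) with its regular system of parameters `(t', y'ᵢ = yᵢ/t)`.
PROVED along the iterates `σ.iter j` (all definitions are by structural recursion / choice from the
cited existence theorems, no new mathematics is asserted):

* `AxStage.iter_stalkIdeal` — the composite stalk map `Ψ_j : 𝒪_{X,P} → 𝒪_{X_j,P_j}` computes the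
  stalks of all pulled-back ideal sheaves: `(comp_j^* K)_{P_j} = Ψ_j(K_P) · 𝒪`;
* `AxStage.iter_c_zero`, `AxStage.iter_c_succ` — **`Ψ_j(t) = t_j` and `Ψ_j(yᵢ) = y_{j,i} · t_jʲ`**
  (the axial substitution of `AxialSubstitutionOrder.lean`);
* `AxStage.iter_ringKrullDim`, `AxStage.iter_isClosed_singleton` — dimensions are constant and closed
  points stay closed;
* `AxStage.gen` — the **divisorial restart**: the generisation `ζ` of `P` at the prime `(t)` is a
  stage with `n = 0` (`𝒪_{X,ζ} = (𝒪_{X,P})_{(t)}` is regular of dimension one with uniformizer `t`,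
  Krull's principal ideal theorem), `AxStage.gen_stalkIdeal` (`K_ζ = K_P · 𝒪_{X,ζ}`),
  `AxStage.isLocalization_gen`.

## Sources

* The Stacks Project, Tags 0804, 01J7, 00KW; Krull's Hauptidealsatz Tag 00KV. [StacksProject]
* V. Cossart, O. Piltant, J. Algebra 320 (2008), proof of Prop. 4.2. [CossartPiltant2008]
* J. Lipman, Ann. of Math. 107 (1978), §(1g) (quadratic sequences along a valuation). [Lipman1978]
-/

noncomputable section

open CategoryTheory AlgebraicGeometry TopologicalSpace IsLocalRing

namespace Literature.AlgebraicGeometry.Resolution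

universe u

open Scheme.IdealSheafData

/-- **A stage of an axial tower**: an integral locally Noetherian scheme `X`, a point `P` and a
regular system of parameters `c = (t, y₁, …, y_n)` of the regular local ring `𝒪_{X,P}` (part of
one, generating `𝔪_P`; `t = c 0` is the axis parameter). [cite: StacksProject, Tag 0804] -/
structure AxStage (n : ℕ) : Type (u + 1) where
  /-- the scheme -/
  X : Scheme.{u}
  /-- it is integral -/
  [isIntegral : IsIntegral X]
  /-- it is locally Noetherian -/
  [isLocallyNoetherian : IsLocallyNoetherian X]
  /-- the point -/
  P : X
  /-- the regular system of parameters `(t, y)` at `P` -/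
  c : Fin (n + 1) → X.presheaf.stalk P
  /-- it generates the maximal ideal -/
  span_eq : Ideal.span (Set.range c) = maximalIdeal (X.presheaf.stalk P)
  /-- it is part of a regular system of parameters (so `𝒪_{X,P}` is regular) -/
  isRsopPart : IsRsopPart c

namespace AxStage

attribute [instance] isIntegral isLocallyNoetherian

variable {n : ℕ} (σ : AxStage.{u} n)

/-- The centre `cl{P}` (reduced). [cite: StacksProject, Tag 0804] -/
def centre : Closeds σ.X := ⟨closure {σ.P}, isClosed_closure⟩

/-- `dim 𝒪_{X,P} = n + 1`. [cite: Matsumura1987, Thm. 14.2] -/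
theorem ringKrullDim_stalk : ringKrullDim (σ.X.presheaf.stalk σ.P) = (n + 1 : ℕ) := by
  haveI := σ.isRsopPart.isRegularLocalRing
  have h := σ.isRsopPart.ringKrullDim_quotient_add
  rw [σ.span_eq] at h
  haveI : IsField (σ.X.presheaf.stalk σ.P ⧸ maximalIdeal (σ.X.presheaf.stalk σ.P)) :=
    Ideal.Quotient.maximal_ideal_iff_isField_quotient _ |>.mp inferInstance
  rw [ringKrullDim_eq_zero_of_isField this, zero_add] at h
  exact h.symm

/-- The centre ideal is nonzero: `P` is not the generic point (its local ring has positive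
dimension). [cite: StacksProject, Tag 01J7] -/
theorem vanishingIdeal_centre_ne_bot : vanishingIdeal σ.centre ≠ ⊥ := by
  intro h
  -- then `(𝓘_{cl P})_P = 𝔪_P = ⊥`, so the parameter `t` vanishes
  have h1 : stalkIdeal (vanishingIdeal σ.centre) σ.P = maximalIdeal _ := stalkIdeal_vanishingIdeal_closure_self σ.P
  rw [h] at h1
  have h2 : stalkIdeal (⊥ : σ.X.IdealSheafData) σ.P = ⊥ := by
    obtain ⟨U, hU, hxU, -⟩ :=
      exists_isAffineOpen_mem_and_subset (X := σ.X) (x := σ.P) (U := ⊤) (Opens.mem_top _)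
    rw [stalkIdeal_eq_map_germ _ ⟨U, hU⟩ hxU, Scheme.IdealSheafData.ideal_bot, Pi.bot_apply, Ideal.map_bot]
  rw [h2] at h1
  have h3 : σ.c 0 ∈ maximalIdeal (σ.X.presheaf.stalk σ.P) := σ.isRsopPart.mem_maximalIdeal 0
  rw [← h1, Ideal.mem_bot] at h3
  exact σ.isRsopPart.ne_zero 0 h3

/-- The next scheme: the chosen blowing up along `cl{P}`. [cite: StacksProject, Tag 0804] -/
def X' : Scheme.{u} := blowup (vanishingIdeal σ.centre)

/-- Its structure map. [cite: StacksProject, Tag 0804] -/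
def π : σ.X' ⟶ σ.X := blowup.π (vanishingIdeal σ.centre)

/-- It is a blowing up along `𝓘_{cl P}`. [cite: GortzWedhorn2020, Def. 13.90, p. 413] -/
theorem isBlowup : IsBlowup σ.π (vanishingIdeal σ.centre) := blowup.isBlowup _

/-- The blowing up of an integral scheme along a nonzero ideal is integral. [cite: StacksProject, Tag 02ND] -/
instance isIntegral_X' : IsIntegral σ.X' := σ.isBlowup.isIntegral σ.vanishingIdeal_centre_ne_bot

/-- The blowing up of a locally Noetherian scheme is locally Noetherian (it is proper).
[cite: StacksProject, Tag 02NS] -/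
instance isLocallyNoetherian_X' : IsLocallyNoetherian σ.X' := by
  haveI : IsProper σ.π := σ.isBlowup.isProper
  exact LocallyOfFiniteType.isLocallyNoetherian σ.π

/-- The axial point exists (restated for the chosen blowing up). [cite: StacksProject, Tag 0804] -/
theorem exists_next : ∃ (x' : σ.X') (_ : σ.π x' = σ.P) (ψ : σ.X.presheaf.stalk σ.P →+* σ.X'.presheaf.stalk x')
    (c' : Fin (n + 1) → σ.X'.presheaf.stalk x'),
    (∀ K : σ.X.IdealSheafData, stalkIdeal (K.comap σ.π) x' = (stalkIdeal K σ.P).map ψ) ∧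
    IsRsopPart c' ∧ Ideal.span (Set.range c') = maximalIdeal (σ.X'.presheaf.stalk x') ∧
    c' 0 = ψ (σ.c 0) ∧ (∀ i : Fin n, ψ (σ.c i.succ) = c' 0 * c' i.succ) ∧
    ringKrullDim (σ.X'.presheaf.stalk x') = ringKrullDim (σ.X.presheaf.stalk σ.P) :=
  exists_axialPoint σ.P σ.c σ.span_eq σ.isRsopPart σ.isBlowup

/-- **The next stage**: the blowing up along `cl{P}` pointed at the axial point, with the regular
system of parameters `(t', y'ᵢ)`, `ψ(t) = t'`, `ψ(yᵢ) = t' y'ᵢ`. [cite: StacksProject, Tag 0804] -/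
def next : AxStage.{u} n where
  X := σ.X'
  P := σ.exists_next.choose
  c := σ.exists_next.choose_spec.choose_spec.choose_spec.choose
  span_eq := σ.exists_next.choose_spec.choose_spec.choose_spec.choose_spec.2.2.1
  isRsopPart := σ.exists_next.choose_spec.choose_spec.choose_spec.choose_spec.2.1

/-- The stalk map `ψ : 𝒪_{X,P} → 𝒪_{X',P'}` at the axial point. [cite: StacksProject, Tag 0804] -/
def ψ : σ.X.presheaf.stalk σ.P →+* σ.next.X.presheaf.stalk σ.next.P :=
  σ.exists_next.choose_spec.choose_spec.choose

/-- `π P' = P`. [cite: StacksProject, Tag 0804] -/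
theorem next_π : σ.π σ.next.P = σ.P := σ.exists_next.choose_spec.choose

/-- `(π^* K)_{P'} = ψ(K_P) · 𝒪_{X',P'}`. [cite: StacksProject, Tag 0804] -/
theorem next_stalkIdeal (K : σ.X.IdealSheafData) :
    stalkIdeal (K.comap σ.π) σ.next.P = (stalkIdeal K σ.P).map σ.ψ :=
  σ.exists_next.choose_spec.choose_spec.choose_spec.choose_spec.1 K

/-- `t' = ψ(t)`. [cite: StacksProject, Tag 0804] -/
theorem next_c_zero : σ.next.c 0 = σ.ψ (σ.c 0) :=
  σ.exists_next.choose_spec.choose_spec.choose_spec.choose_spec.2.2.2.1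

/-- `ψ(yᵢ) = t' · y'ᵢ`. [cite: StacksProject, Tag 0804] -/
theorem next_c_succ (i : Fin n) : σ.ψ (σ.c i.succ) = σ.next.c 0 * σ.next.c i.succ :=
  σ.exists_next.choose_spec.choose_spec.choose_spec.choose_spec.2.2.2.2.1 i

/-- `dim 𝒪_{X',P'} = dim 𝒪_{X,P}`. [cite: StacksProject, Tag 0804] -/
theorem next_ringKrullDim :
    ringKrullDim (σ.next.X.presheaf.stalk σ.next.P) = ringKrullDim (σ.X.presheaf.stalk σ.P) :=
  σ.exists_next.choose_spec.choose_spec.choose_spec.choose_spec.2.2.2.2.2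

/-- Closed points stay closed. [cite: StacksProject, Tag 01J7] -/
theorem next_isClosed_singleton (h : IsClosed ({σ.P} : Set σ.X)) :
    IsClosed ({σ.next.P} : Set σ.next.X) :=
  σ.isBlowup.isClosed_singleton_axialPoint σ.next_π h σ.next_ringKrullDim

/-- The exceptional ideal at `P'` is `(t')`. [cite: StacksProject, Tag 0804] -/
theorem next_stalkIdeal_exceptional :
    stalkIdeal ((vanishingIdeal σ.centre).comap σ.π) σ.next.P = Ideal.span {σ.next.c 0} := by
  have h1 : stalkIdeal (vanishingIdeal σ.centre) σ.P = Ideal.span (Set.range σ.c) :=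
    (stalkIdeal_vanishingIdeal_closure_self σ.P).trans σ.span_eq.symm
  have h2 := σ.next_stalkIdeal (vanishingIdeal σ.centre)
  rw [h1] at h2
  refine h2.trans ?_
  rw [σ.next_c_zero]
  exact Ideal.map_span_range_eq_span_singleton σ.ψ σ.c 0 (fun l => Fin.cases 1 (fun i => σ.next.c i.succ) l)
    fun l => by
      refine Fin.cases ?_ (fun i => ?_) l
      · simp
      · rw [← σ.next_c_zero]
        simpa using σ.next_c_succ i

/-! ## Iteration -/

/-- The `j`-th iterate of the axial tower. [cite: StacksProject, Tag 0804] -/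
def iter : ℕ → AxStage.{u} n
  | 0 => σ
  | j + 1 => (iter j).next

/-- `iter 0 = σ`. [cite: StacksProject, Tag 0804] -/
@[simp] theorem iter_zero : σ.iter 0 = σ := rfl

/-- `iter (j+1) = (iter j).next`. [cite: StacksProject, Tag 0804] -/
theorem iter_succ (j : ℕ) : σ.iter (j + 1) = (σ.iter j).next := rfl

/-- The composite structure map `X_j → X`. [cite: StacksProject, Tag 0804] -/
def comp : (j : ℕ) → ((σ.iter j).X ⟶ σ.X)
  | 0 => 𝟙 _
  | j + 1 => (σ.iter j).π ≫ comp j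

/-- The composite stalk map `Ψ_j : 𝒪_{X,P} → 𝒪_{X_j,P_j}`. [cite: StacksProject, Tag 0804] -/
def Ψ : (j : ℕ) → (σ.X.presheaf.stalk σ.P →+* (σ.iter j).X.presheaf.stalk (σ.iter j).P)
  | 0 => RingHom.id _
  | j + 1 => (σ.iter j).ψ.comp (Ψ j)

/-- **`(comp_j^* K)_{P_j} = Ψ_j(K_P) · 𝒪`** for every ideal sheaf `K` on `X`. [cite: StacksProject, Tag 0804] -/
theorem iter_stalkIdeal (K : σ.X.IdealSheafData) :
    ∀ j : ℕ, stalkIdeal (K.comap (σ.comp j)) (σ.iter j).P = (stalkIdeal K σ.P).map (σ.Ψ j)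
  | 0 => by
    change stalkIdeal (K.comap (𝟙 _)) σ.P = (stalkIdeal K σ.P).map (RingHom.id _)
    rw [comap_id, Ideal.map_id]
  | j + 1 => by
    change stalkIdeal (K.comap ((σ.iter j).π ≫ σ.comp j)) (σ.iter j).next.P =
      (stalkIdeal K σ.P).map ((σ.iter j).ψ.comp (σ.Ψ j))
    rw [comap_comp, (σ.iter j).next_stalkIdeal, iter_stalkIdeal K j, Ideal.map_map]

/-- **`Ψ_j(t) = t_j`**. [cite: StacksProject, Tag 0804] -/
theorem iter_c_zero : ∀ j : ℕ, (σ.iter j).c 0 = σ.Ψ j (σ.c 0)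
  | 0 => rfl
  | j + 1 => by
    change (σ.iter j).next.c 0 = (σ.iter j).ψ (σ.Ψ j (σ.c 0))
    rw [← iter_c_zero j, (σ.iter j).next_c_zero]

/-- **The axial substitution `Ψ_j(yᵢ) = y_{j,i} · t_jʲ`.** [cite: CossartPiltant2008, proof of Prop. 4.2, (10)–(11)] -/
theorem iter_c_succ (i : Fin n) :
    ∀ j : ℕ, σ.Ψ j (σ.c i.succ) = (σ.iter j).c i.succ * ((σ.iter j).c 0) ^ j
  | 0 => by
    have h : σ.c i.succ = σ.c i.succ * σ.c 0 ^ 0 := by rw [pow_zero, mul_one]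
    exact h
  | j + 1 => by
    change (σ.iter j).ψ (σ.Ψ j (σ.c i.succ)) = (σ.iter j).next.c i.succ * ((σ.iter j).next.c 0) ^ (j + 1)
    rw [iter_c_succ i j, map_mul, map_pow, (σ.iter j).next_c_succ i, ← (σ.iter j).next_c_zero]
    ring

/-- Dimensions along the tower are constant (`= n + 1`). [cite: Matsumura1987, Thm. 14.2] -/
theorem iter_ringKrullDim (j : ℕ) :
    ringKrullDim ((σ.iter j).X.presheaf.stalk (σ.iter j).P) = (n + 1 : ℕ) :=
  (σ.iter j).ringKrullDim_stalk

/-- Closed points stay closed along the tower. [cite: StacksProject, Tag 01J7] -/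
theorem iter_isClosed_singleton (h : IsClosed ({σ.P} : Set σ.X)) :
    ∀ j : ℕ, IsClosed ({(σ.iter j).P} : Set (σ.iter j).X)
  | 0 => h
  | j + 1 => (σ.iter j).next_isClosed_singleton (iter_isClosed_singleton h j)

/-! ## The divisorial restart: the generisation of `P` at the prime `(t)` -/

/-- The ideal `(t) ⊆ 𝒪_{X,P}` of the axis parameter is prime. [cite: Matsumura1987, Thm. 14.3] -/
theorem isPrime_span_c_zero : (Ideal.span {σ.c 0} : Ideal (σ.X.presheaf.stalk σ.P)).IsPrime := by
  rw [Ideal.span_singleton_prime (σ.isRsopPart.ne_zero 0)]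
  exact σ.isRsopPart.prime 0

/-- The point `ζ ⤳ P` of `X` with prime `(t)`: the generic point of the hypersurface `t = 0`
through `P` (of the exceptional divisor, when `σ` is a successor stage). [cite: StacksProject, Tag 01J7] -/
def genPoint : σ.X :=
  σ.X.fromSpecStalk σ.P ⟨Ideal.span {σ.c 0}, σ.isPrime_span_c_zero⟩

/-- `ζ ⤳ P`. [cite: StacksProject, Tag 01J7] -/
theorem genPoint_specializes : σ.genPoint ⤳ σ.P := fromSpecStalk_specializes _

/-- `𝔭_ζ = (t)`. [cite: StacksProject, Tag 01J7] -/
theorem primeOfSpecializes_genPoint :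
    primeOfSpecializes σ.genPoint_specializes = Ideal.span {σ.c 0} :=
  primeOfSpecializes_fromSpecStalk _

/-- `𝒪_{X,ζ}` is the localisation of `𝒪_{X,P}` at `(t)` (along `stalkSpecializes`). [cite: StacksProject, Tag 01J7] -/
theorem isLocalization_gen :
    @IsLocalization.AtPrime _ _ (σ.X.presheaf.stalk σ.genPoint) _
      (σ.X.presheaf.stalkSpecializes σ.genPoint_specializes).hom.toAlgebra
      (Ideal.span {σ.c 0} : Ideal (σ.X.presheaf.stalk σ.P)) σ.isPrime_span_c_zero := by
  have h := Literature.AlgebraicGeometry.Motives.isLocalizationAtPrime_stalkSpecializes σ.genPoint_specializes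
  have h' : (maximalIdeal (σ.X.presheaf.stalk σ.genPoint)).comap
      (σ.X.presheaf.stalkSpecializes σ.genPoint_specializes).hom = Ideal.span {σ.c 0} :=
    σ.primeOfSpecializes_genPoint
  convert h using 2
  exact h'.symm

/-- The data of the restart: `𝒪_{X,ζ}` is regular of dimension one with uniformizer the image of
`t`. [cite: StacksProject, Tag 00KV] -/
theorem gen_data :
    Ideal.span (Set.range ![(σ.X.presheaf.stalkSpecializes σ.genPoint_specializes).hom (σ.c 0)]) =
        maximalIdeal (σ.X.presheaf.stalk σ.genPoint) ∧
      IsRsopPart ![(σ.X.presheaf.stalkSpecializes σ.genPoint_specializes).hom (σ.c 0)] ∧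
      ringKrullDim (σ.X.presheaf.stalk σ.genPoint) = 1 := by
  classical
  haveI := σ.isRsopPart.isRegularLocalRing
  haveI : IsDomain (σ.X.presheaf.stalk σ.P) := isDomain_of_isRegularLocalRing _
  let L := σ.X.presheaf.stalk σ.genPoint
  let φ : σ.X.presheaf.stalk σ.P →+* L := (σ.X.presheaf.stalkSpecializes σ.genPoint_specializes).hom
  letI := φ.toAlgebra
  haveI hprime := σ.isPrime_span_c_zero
  haveI : IsLocalization.AtPrime L (Ideal.span {σ.c 0} : Ideal (σ.X.presheaf.stalk σ.P)) :=
    σ.isLocalization_gen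
  -- the maximal ideal is `(t)`
  have hrange : Set.range ![φ (σ.c 0)] = {φ (σ.c 0)} := by ext a; simp
  have hmax : maximalIdeal L = Ideal.span {φ (σ.c 0)} := by
    rw [← IsLocalization.AtPrime.map_eq_maximalIdeal (Ideal.span {σ.c 0}) L, Ideal.map_span,
      Set.image_singleton]
    rfl
  have hspan : Ideal.span (Set.range ![φ (σ.c 0)]) = maximalIdeal L := by rw [hrange, hmax]
  -- the height of `(t)` is one (Krull), so `dim L = 1`
  have hht : (Ideal.span {σ.c 0} : Ideal (σ.X.presheaf.stalk σ.P)).height = 1 := by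
    apply le_antisymm
    · exact Ideal.height_le_one_of_isPrincipal_of_mem_minimalPrimes (Ideal.span {σ.c 0}) _
        (by rw [Ideal.minimalPrimes_eq_subsingleton_self]; exact Set.mem_singleton _)
    · rw [Order.one_le_iff_ne_zero, Ne, Ideal.height_eq_zero_iff_eq_bot, Ideal.span_singleton_eq_bot]
      exact σ.isRsopPart.ne_zero 0
  have hdim : ringKrullDim L = 1 := by
    rw [IsLocalization.AtPrime.ringKrullDim_eq_height (Ideal.span {σ.c 0} : Ideal (σ.X.presheaf.stalk σ.P)) L,
      hht]
    rfl
  -- hence regular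
  have hfin : (maximalIdeal L).spanFinrank ≤ 1 := by
    rw [hmax]
    refine (Submodule.spanFinrank_span_le_ncard_of_finite (Set.finite_singleton _)).trans ?_
    rw [Set.ncard_singleton]
  haveI : IsRegularLocalRing L :=
    IsRegularLocalRing.of_spanFinrank_maximalIdeal_le L (by rw [hdim]; exact_mod_cast hfin)
  refine ⟨hspan, ⟨inferInstance, 0, Fin.elim0, by rw [hdim]; rfl, ?_⟩, hdim⟩
  rw [Set.range_eq_empty (Fin.elim0 : Fin 0 → L), Set.union_empty]
  exact hspan

/-- **The divisorial restart** of the tower at `σ`: the stage (with `n = 0`) at the generisation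
`ζ` of `P` at `(t)`, whose local ring `(𝒪_{X,P})_{(t)}` is a discrete valuation ring with
uniformizer `t`. [cite: StacksProject, Tag 00KV] -/
def gen : AxStage.{u} 0 where
  X := σ.X
  P := σ.genPoint
  c := ![(σ.X.presheaf.stalkSpecializes σ.genPoint_specializes).hom (σ.c 0)]
  span_eq := σ.gen_data.1
  isRsopPart := σ.gen_data.2.1

/-- `gen.P = ζ ⤳ P`. [cite: StacksProject, Tag 01J7] -/
theorem gen_specializes : σ.gen.P ⤳ σ.P := σ.genPoint_specializes

/-- `dim 𝒪_{X,ζ} = 1`. [cite: StacksProject, Tag 00KV] -/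
theorem gen_ringKrullDim : ringKrullDim (σ.gen.X.presheaf.stalk σ.gen.P) = 1 := σ.gen_data.2.2

/-- The uniformizer of the restart is the image of `t`. [cite: StacksProject, Tag 00KV] -/
theorem gen_c_zero : σ.gen.c 0 = (σ.X.presheaf.stalkSpecializes σ.gen_specializes).hom (σ.c 0) := rfl

/-- `K_ζ = K_P · 𝒪_{X,ζ}`. [cite: StacksProject, Tag 01J7] -/
theorem gen_stalkIdeal (K : σ.X.IdealSheafData) :
    stalkIdeal K σ.gen.P = (stalkIdeal K σ.P).map (σ.X.presheaf.stalkSpecializes σ.gen_specializes).hom :=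
  (stalkIdeal_map_stalkSpecializes K σ.gen_specializes).symm

end AxStage

end Literature.AlgebraicGeometry.Resolution

end
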